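import Summits.BirchSwinnertonDyer.BirchSwinnertonDyer.Theorems.ManinLocalTwoThreeNewformPinningFortyFive
import Summits.BirchSwinnertonDyer.BirchSwinnertonDyer.Theorems.ManinLocalTwoThreeEtaBasisFortyFiveC
import Summits.BirchSwinnertonDyer.BirchSwinnertonDyer.Theorems.ManinLocalTwoThreeAtkinLehnerFormsFortyFive
import HarnessLib

/-!
# Level 45: `φ₄₅|₂W₅ = φ₄₅` FACT-FREE — the linear identity `φ₄₅ = −15B1 − 3B2 − ⅗B3 + (8/5)D4 − 2D5 + ⅕D7 − ⅕D8 − D9 − 2B10` in `M₂(Γ₀(45))`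
# and `φ₄₅(A₀σ) = (9σ+1)²/5 · φ₄₅((σ−1)/5)` at the cusp `1/9`

Cell `bsd-f2-manin`, route `ManinLocalTwoThree`, crux C3 `ManinPrimeToThreeAtNine` (stmt-BirchSwinnertonDyer-22968: `3² ∣ 45`), prover seat p2 gen 28;
`--supports` (helper).  The Atkin–Lehner law of the newform at the second fibre cusp, WITHOUT newform theory: the per-form `W₅`-laws
(`…AtkinLehnerFormsFortyFive`) turn `φ₄₅(A₀σ)` into `(9σ+1)²/5` times a combination of the duals `B3, B2, B1, D4, D5, D7, D8, D9, B10` at `τ' = (σ−1)/5`,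
and that combination IS `φ₄₅` — an identity between two elements of `M₂(Γ₀(45))` decided by their ten pivot coefficients (`eq_of_pivots_fortyFive`).
* §1 the pivot coefficients of the duals `D4, D5, D7, D8, D9`;  * §2 `dual_eq_phi_fortyFive` (modular forms) and `dual_apply_eq_phi_fortyFive` (functions);
* §3 **`phi_A0_smul`**: for any `φ` with `⇑φ = −3B1 + 3B2 − 3B3 − 8B4 − 2B5 + B7 − B8 + B9 + 2B10` (every `X₀(45)`-datum's newform, `f_apply_eq_fortyFive`),
  `φ(A₀σ) = (9σ+1)²/5 · φ(τ')` — the input of (I2a)₄₅ at the cusp `1/9`.  Nothing here proves C3, Manin's conjecture or BSD.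
[cite: AtkinLehner1970, Lemma 7, Thm. 3] [cite: DiamondShurman2005, Thm. 3.5.1]
-/

set_option autoImplicit false
-- lint-debt: the directory name repeats the summit name (sibling precedent `ManinLocalTwoThreeNewformPinningFortyFour.lean`)
set_option linter.dupNamespace false

noncomputable section

open Complex Polynomial
open UpperHalfPlane hiding I
open scoped MatrixGroups ModularForm
open CongruenceSubgroup
open Literature.NumberTheory.ModularForms
open Literature.NumberTheory.EllipticCurves Literature.NumberTheory.EllipticCurves.ModularForms

namespace Summit.BirchSwinnertonDyer.BirchSwinnertonDyer.Theorems.ManinLocalTwoThree.LevelFortyFive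

/-! ## §1 Pivot coefficients of the duals -/

/-- The ten pivot `q`-coefficients of `D4`. [cite: Koehler2011, §2.1] -/
theorem cols_D4 :
    (qExpansion 1 ⇑(D4)).coeff 1 = (0 : ℂ) ∧
    (qExpansion 1 ⇑(D4)).coeff 2 = (1 : ℂ) ∧
    (qExpansion 1 ⇑(D4)).coeff 3 = (0 : ℂ) ∧
    (qExpansion 1 ⇑(D4)).coeff 4 = (0 : ℂ) ∧
    (qExpansion 1 ⇑(D4)).coeff 5 = (-3 : ℂ) ∧
    (qExpansion 1 ⇑(D4)).coeff 6 = (0 : ℂ) ∧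
    (qExpansion 1 ⇑(D4)).coeff 8 = (0 : ℂ) ∧
    (qExpansion 1 ⇑(D4)).coeff 9 = (0 : ℂ) ∧
    (qExpansion 1 ⇑(D4)).coeff 10 = (0 : ℂ) ∧
    (qExpansion 1 ⇑(D4)).coeff 15 = (0 : ℂ) := by
  refine ⟨?_, ?_, ?_, ?_, ?_, ?_, ?_, ?_, ?_, ?_⟩ <;> (rw [coeff_D4 _ (by norm_num)]; norm_num)

/-- The ten pivot `q`-coefficients of `D5`. [cite: Koehler2011, §2.1] -/
theorem cols_D5 :
    (qExpansion 1 ⇑(D5)).coeff 1 = (0 : ℂ) ∧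
    (qExpansion 1 ⇑(D5)).coeff 2 = (0 : ℂ) ∧
    (qExpansion 1 ⇑(D5)).coeff 3 = (0 : ℂ) ∧
    (qExpansion 1 ⇑(D5)).coeff 4 = (0 : ℂ) ∧
    (qExpansion 1 ⇑(D5)).coeff 5 = (0 : ℂ) ∧
    (qExpansion 1 ⇑(D5)).coeff 6 = (1 : ℂ) ∧
    (qExpansion 1 ⇑(D5)).coeff 8 = (0 : ℂ) ∧
    (qExpansion 1 ⇑(D5)).coeff 9 = (-4 : ℂ) ∧
    (qExpansion 1 ⇑(D5)).coeff 10 = (0 : ℂ) ∧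
    (qExpansion 1 ⇑(D5)).coeff 15 = (10 : ℂ) := by
  refine ⟨?_, ?_, ?_, ?_, ?_, ?_, ?_, ?_, ?_, ?_⟩ <;> (rw [coeff_D5 _ (by norm_num)]; norm_num)

/-- The ten pivot `q`-coefficients of `D7`. [cite: Koehler2011, §2.1] -/
theorem cols_D7 :
    (qExpansion 1 ⇑(D7)).coeff 1 = (3 : ℂ) ∧
    (qExpansion 1 ⇑(D7)).coeff 2 = (9 : ℂ) ∧
    (qExpansion 1 ⇑(D7)).coeff 3 = (12 : ℂ) ∧
    (qExpansion 1 ⇑(D7)).coeff 4 = (21 : ℂ) ∧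
    (qExpansion 1 ⇑(D7)).coeff 5 = (18 : ℂ) ∧
    (qExpansion 1 ⇑(D7)).coeff 6 = (36 : ℂ) ∧
    (qExpansion 1 ⇑(D7)).coeff 8 = (45 : ℂ) ∧
    (qExpansion 1 ⇑(D7)).coeff 9 = (12 : ℂ) ∧
    (qExpansion 1 ⇑(D7)).coeff 10 = (54 : ℂ) ∧
    (qExpansion 1 ⇑(D7)).coeff 15 = (72 : ℂ) := by
  refine ⟨?_, ?_, ?_, ?_, ?_, ?_, ?_, ?_, ?_, ?_⟩ <;> (rw [coeff_D7 _ (by norm_num)]; norm_num)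

/-- The ten pivot `q`-coefficients of `D8`. [cite: Koehler2011, §2.1] -/
theorem cols_D8 :
    (qExpansion 1 ⇑(D8)).coeff 1 = (-2 : ℂ) ∧
    (qExpansion 1 ⇑(D8)).coeff 2 = (-1 : ℂ) ∧
    (qExpansion 1 ⇑(D8)).coeff 3 = (2 : ℂ) ∧
    (qExpansion 1 ⇑(D8)).coeff 4 = (1 : ℂ) ∧
    (qExpansion 1 ⇑(D8)).coeff 5 = (3 : ℂ) ∧
    (qExpansion 1 ⇑(D8)).coeff 6 = (-4 : ℂ) ∧
    (qExpansion 1 ⇑(D8)).coeff 8 = (0 : ℂ) ∧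
    (qExpansion 1 ⇑(D8)).coeff 9 = (-3 : ℂ) ∧
    (qExpansion 1 ⇑(D8)).coeff 10 = (9 : ℂ) ∧
    (qExpansion 1 ⇑(D8)).coeff 15 = (12 : ℂ) := by
  refine ⟨?_, ?_, ?_, ?_, ?_, ?_, ?_, ?_, ?_, ?_⟩ <;> (rw [coeff_D8 _ (by norm_num)]; norm_num)

/-- The ten pivot `q`-coefficients of `D9`. [cite: Koehler2011, §2.1] -/
theorem cols_D9 :
    (qExpansion 1 ⇑(D9)).coeff 1 = (0 : ℂ) ∧
    (qExpansion 1 ⇑(D9)).coeff 2 = (0 : ℂ) ∧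
    (qExpansion 1 ⇑(D9)).coeff 3 = (0 : ℂ) ∧
    (qExpansion 1 ⇑(D9)).coeff 4 = (1 : ℂ) ∧
    (qExpansion 1 ⇑(D9)).coeff 5 = (-2 : ℂ) ∧
    (qExpansion 1 ⇑(D9)).coeff 6 = (-1 : ℂ) ∧
    (qExpansion 1 ⇑(D9)).coeff 8 = (3 : ℂ) ∧
    (qExpansion 1 ⇑(D9)).coeff 9 = (4 : ℂ) ∧
    (qExpansion 1 ⇑(D9)).coeff 10 = (-7 : ℂ) ∧
    (qExpansion 1 ⇑(D9)).coeff 15 = (-10 : ℂ) := by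
  refine ⟨?_, ?_, ?_, ?_, ?_, ?_, ?_, ?_, ?_, ?_⟩ <;> (rw [coeff_D9 _ (by norm_num)]; norm_num)

/-! ## §2 The linear identity in `M₂(Γ₀(45))` -/

/-- The dual coordinates `(−15, −3, −3/5, 8/5, −2, 0, 1/5, −1/5, −1, −2)` on `(B1, B2, B3, D4, D5, B6, D7, D8, D9, B10)`. [folklore] -/
abbrev dualCoords : Fin 10 → ℂ := ![(-15 : ℂ), (-3 : ℂ), ((-3 : ℂ) / 5), ((8 : ℂ) / 5), (-2 : ℂ), (0 : ℂ), ((1 : ℂ) / 5), ((-1 : ℂ) / 5), (-1 : ℂ), (-2 : ℂ)]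

/-- The dual family `(B1, B2, B3, D4, D5, B6, D7, D8, D9, B10)` (`B6` with coordinate `0` pads to ten). [folklore] -/
abbrev dualForms : Fin 10 → ModularForm (Gamma0 45) 2 := ![B1, B2, B3, D4, D5, B6, D7, D8, D9, B10]

/-- **`Σ dualCoords i • dualForms i = Σ phiCoords i • Bᵢ` in `M₂(Γ₀(45))`** (both have the pivot vector `(1, 1, 0, −1, −1, 0, −3, 0, −1, 0)` of `45a`).
[cite: DiamondShurman2005, Thm. 3.5.1] -/
theorem dual_eq_phi_fortyFive : (∑ i, dualCoords i • dualForms i) = ∑ i, phiCoords i • basisForms i := by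
  obtain ⟨p1, p2, p3, p4, p5, p6, p8, p9, p10, p15⟩ := coeff_Phi45_pivots
  obtain ⟨b1_0, b1_1, b1_2, b1_3, b1_4, b1_5, b1_6, b1_8, b1_9, b1_10, b1_15, b1_16, b1_20, b1_25⟩ := cols_B1
  obtain ⟨b2_0, b2_1, b2_2, b2_3, b2_4, b2_5, b2_6, b2_8, b2_9, b2_10, b2_15, b2_16, b2_20, b2_25⟩ := cols_B2
  obtain ⟨b3_0, b3_1, b3_2, b3_3, b3_4, b3_5, b3_6, b3_8, b3_9, b3_10, b3_15, b3_16, b3_20, b3_25⟩ := cols_B3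
  obtain ⟨b6_0, b6_1, b6_2, b6_3, b6_4, b6_5, b6_6, b6_8, b6_9, b6_10, b6_15, b6_16, b6_20, b6_25⟩ := cols_B6
  obtain ⟨b10_0, b10_1, b10_2, b10_3, b10_4, b10_5, b10_6, b10_8, b10_9, b10_10, b10_15, b10_16, b10_20, b10_25⟩ := cols_B10
  obtain ⟨d4_1, d4_2, d4_3, d4_4, d4_5, d4_6, d4_8, d4_9, d4_10, d4_15⟩ := cols_D4
  obtain ⟨d5_1, d5_2, d5_3, d5_4, d5_5, d5_6, d5_8, d5_9, d5_10, d5_15⟩ := cols_D5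
  obtain ⟨d7_1, d7_2, d7_3, d7_4, d7_5, d7_6, d7_8, d7_9, d7_10, d7_15⟩ := cols_D7
  obtain ⟨d8_1, d8_2, d8_3, d8_4, d8_5, d8_6, d8_8, d8_9, d8_10, d8_15⟩ := cols_D8
  obtain ⟨d9_1, d9_2, d9_3, d9_4, d9_5, d9_6, d9_8, d9_9, d9_10, d9_15⟩ := cols_D9
  refine eq_of_pivots_fortyFive _ _ fun n hn ↦ ?_
  simp only [Finset.mem_insert, Finset.mem_singleton] at hn
  rcases hn with rfl | rfl | rfl | rfl | rfl | rfl | rfl | rfl | rfl | rfl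
  · rw [p1, coeff_sum_smul]
    simp only [Fin.sum_univ_succ, Fin.sum_univ_zero, dualForms, dualCoords, Matrix.cons_val_zero, Matrix.cons_val_succ, b1_1, b2_1, b3_1, d4_1, d5_1, b6_1, d7_1, d8_1, d9_1, b10_1]
    norm_num
  · rw [p2, coeff_sum_smul]
    simp only [Fin.sum_univ_succ, Fin.sum_univ_zero, dualForms, dualCoords, Matrix.cons_val_zero, Matrix.cons_val_succ, b1_2, b2_2, b3_2, d4_2, d5_2, b6_2, d7_2, d8_2, d9_2, b10_2]
    norm_num
  · rw [p3, coeff_sum_smul]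
    simp only [Fin.sum_univ_succ, Fin.sum_univ_zero, dualForms, dualCoords, Matrix.cons_val_zero, Matrix.cons_val_succ, b1_3, b2_3, b3_3, d4_3, d5_3, b6_3, d7_3, d8_3, d9_3, b10_3]
    norm_num
  · rw [p4, coeff_sum_smul]
    simp only [Fin.sum_univ_succ, Fin.sum_univ_zero, dualForms, dualCoords, Matrix.cons_val_zero, Matrix.cons_val_succ, b1_4, b2_4, b3_4, d4_4, d5_4, b6_4, d7_4, d8_4, d9_4, b10_4]
    norm_num
  · rw [p5, coeff_sum_smul]
    simp only [Fin.sum_univ_succ, Fin.sum_univ_zero, dualForms, dualCoords, Matrix.cons_val_zero, Matrix.cons_val_succ, b1_5, b2_5, b3_5, d4_5, d5_5, b6_5, d7_5, d8_5, d9_5, b10_5]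
    norm_num
  · rw [p6, coeff_sum_smul]
    simp only [Fin.sum_univ_succ, Fin.sum_univ_zero, dualForms, dualCoords, Matrix.cons_val_zero, Matrix.cons_val_succ, b1_6, b2_6, b3_6, d4_6, d5_6, b6_6, d7_6, d8_6, d9_6, b10_6]
    norm_num
  · rw [p8, coeff_sum_smul]
    simp only [Fin.sum_univ_succ, Fin.sum_univ_zero, dualForms, dualCoords, Matrix.cons_val_zero, Matrix.cons_val_succ, b1_8, b2_8, b3_8, d4_8, d5_8, b6_8, d7_8, d8_8, d9_8, b10_8]
    norm_num
  · rw [p9, coeff_sum_smul]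
    simp only [Fin.sum_univ_succ, Fin.sum_univ_zero, dualForms, dualCoords, Matrix.cons_val_zero, Matrix.cons_val_succ, b1_9, b2_9, b3_9, d4_9, d5_9, b6_9, d7_9, d8_9, d9_9, b10_9]
    norm_num
  · rw [p10, coeff_sum_smul]
    simp only [Fin.sum_univ_succ, Fin.sum_univ_zero, dualForms, dualCoords, Matrix.cons_val_zero, Matrix.cons_val_succ, b1_10, b2_10, b3_10, d4_10, d5_10, b6_10, d7_10, d8_10, d9_10, b10_10]
    norm_num
  · rw [p15, coeff_sum_smul]
    simp only [Fin.sum_univ_succ, Fin.sum_univ_zero, dualForms, dualCoords, Matrix.cons_val_zero, Matrix.cons_val_succ, b1_15, b2_15, b3_15, d4_15, d5_15, b6_15, d7_15, d8_15, d9_15, b10_15]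
    norm_num

/-- **The identity as functions on `ℍ`**: `−15B1 − 3B2 − ⅗B3 + (8/5)D4 − 2D5 + ⅕D7 − ⅕D8 − D9 − 2B10 = −3B1 + 3B2 − 3B3 − 8B4 − 2B5 + B7 − B8 + B9 + 2B10`.
[cite: DiamondShurman2005, Thm. 3.5.1] -/
theorem dual_apply_eq_phi_fortyFive (τ : ℍ) :
    -15 * B1 τ - 3 * B2 τ - 3 / 5 * B3 τ + 8 / 5 * D4 τ - 2 * D5 τ + 1 / 5 * D7 τ - 1 / 5 * D8 τ - D9 τ - 2 * B10 τ
      = -3 * B1 τ + 3 * B2 τ - 3 * B3 τ - 8 * B4 τ - 2 * B5 τ + B7 τ - B8 τ + B9 τ + 2 * B10 τ := by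
  have h := congrArg (fun H : ModularForm (Gamma0 45) 2 ↦ (⇑H : ℍ → ℂ) τ) dual_eq_phi_fortyFive
  have hs : ∀ (c : ℂ) (G : ModularForm (Gamma0 45) 2) (z : ℍ), (c • G) z = c * G z := fun _ _ _ ↦ rfl
  simp only [Fin.sum_univ_succ, Fin.sum_univ_zero, dualForms, dualCoords, basisForms, phiCoords, Matrix.cons_val_zero, Matrix.cons_val_succ,
    ModularForm.add_apply, ModularForm.zero_apply, hs] at h
  linear_combination h

/-! ## §3 `φ₄₅(A₀σ) = (9σ+1)²/5 · φ₄₅(τ')` -/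

/-- **The Atkin–Lehner law of `φ₄₅` at the cusp `1/9`, fact-free**: for `A₀ = (1 0; 9 1)` and any function `φ` equal to
`−3B1 + 3B2 − 3B3 − 8B4 − 2B5 + B7 − B8 + B9 + 2B10` (the newform of every `X₀(45)`-datum, `f_apply_eq_fortyFive`),
`φ(A₀σ) = (9σ+1)²/5 · φ((σ−1)/5)`, i.e. `φ|₂W₅ = φ`. [cite: AtkinLehner1970, Lemma 7, Thm. 3] -/
theorem phi_A0_smul (φ : ℍ → ℂ) (hφ : φ = fun τ ↦ -3 * B1 τ + 3 * B2 τ - 3 * B3 τ - 8 * B4 τ - 2 * B5 τ + B7 τ - B8 τ + B9 τ + 2 * B10 τ)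
    (A : SL(2, ℤ)) (h00 : A 0 0 = 1) (h01 : A 0 1 = 0) (h10 : A 1 0 = 9) (h11 : A 1 1 = 1) (σ : ℍ) :
    φ (A • σ) = ((9 : ℂ) * σ + 1) ^ 2 / 5 * φ (affPt 1 (-1) 5 one_pos (by norm_num) σ) := by
  subst hφ
  set τ : ℍ := affPt 1 (-1) 5 one_pos (by norm_num) σ with hτ
  have e1 := AtkinLehnerFormsFortyFive.B1_A0_smul A h00 h01 h10 h11 σ
  have e2 := AtkinLehnerFormsFortyFive.B2_A0_smul A h00 h01 h10 h11 σ
  have e3 := AtkinLehnerFormsFortyFive.B3_A0_smul A h00 h01 h10 h11 σ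
  have e4 := AtkinLehnerFormsFortyFive.B4_A0_smul A h00 h01 h10 h11 σ
  have e5 := AtkinLehnerFormsFortyFive.B5_A0_smul A h00 h01 h10 h11 σ
  have e7 := AtkinLehnerFormsFortyFive.B7_A0_smul A h00 h01 h10 h11 σ
  have e8 := AtkinLehnerFormsFortyFive.B8_A0_smul A h00 h01 h10 h11 σ
  have e9 := AtkinLehnerFormsFortyFive.B9_A0_smul A h00 h01 h10 h11 σ
  have e10 := AtkinLehnerFormsFortyFive.B10_A0_smul A h00 h01 h10 h11 σ
  rw [← hτ] at e1 e2 e3 e4 e5 e7 e8 e9 e10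
  have hd := dual_apply_eq_phi_fortyFive τ
  simp only [show ∀ ν : ℍ, (B1 : ℍ → ℂ) ν = etaQuotient 45 rB1 ν from fun _ ↦ rfl, show ∀ ν : ℍ, (B2 : ℍ → ℂ) ν = etaQuotient 45 rB2 ν from fun _ ↦ rfl,
    show ∀ ν : ℍ, (B3 : ℍ → ℂ) ν = etaQuotient 45 rB3 ν from fun _ ↦ rfl, show ∀ ν : ℍ, (B4 : ℍ → ℂ) ν = etaQuotient 45 rB4 ν from fun _ ↦ rfl,
    show ∀ ν : ℍ, (B5 : ℍ → ℂ) ν = etaQuotient 45 rB5 ν from fun _ ↦ rfl, show ∀ ν : ℍ, (B7 : ℍ → ℂ) ν = etaQuotient 45 rB7 ν from fun _ ↦ rfl,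
    show ∀ ν : ℍ, (B8 : ℍ → ℂ) ν = etaQuotient 45 rB8 ν from fun _ ↦ rfl, show ∀ ν : ℍ, (B9 : ℍ → ℂ) ν = etaQuotient 45 rB9 ν from fun _ ↦ rfl,
    show ∀ ν : ℍ, (B10 : ℍ → ℂ) ν = etaQuotient 45 rB10 ν from fun _ ↦ rfl, show ∀ ν : ℍ, (D4 : ℍ → ℂ) ν = etaQuotient 45 rD4 ν from fun _ ↦ rfl,
    show ∀ ν : ℍ, (D5 : ℍ → ℂ) ν = etaQuotient 45 rD5 ν from fun _ ↦ rfl, show ∀ ν : ℍ, (D7 : ℍ → ℂ) ν = etaQuotient 45 rD7 ν from fun _ ↦ rfl,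
    show ∀ ν : ℍ, (D8 : ℍ → ℂ) ν = etaQuotient 45 rD8 ν from fun _ ↦ rfl, show ∀ ν : ℍ, (D9 : ℍ → ℂ) ν = etaQuotient 45 rD9 ν from fun _ ↦ rfl,
    rB1, rB2, rB3, rB4, rB5, rB7, rB8, rB9, rB10, rD4, rD5, rD7, rD8, rD9] at hd ⊢
  rw [e1, e2, e3, e4, e5, e7, e8, e9, e10]
  linear_combination (((9 : ℂ) * σ + 1) ^ 2 / 5) * hd

end Summit.BirchSwinnertonDyer.BirchSwinnertonDyer.Theorems.ManinLocalTwoThree.LevelFortyFive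

end
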